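import Mathlib
import Summits.Ventures.PercRepro2.Defs
import Summits.Ventures.PercRepro2.Graph
import Summits.Ventures.PercRepro2.Explore
import Summits.Ventures.PercRepro2.ExploreHalt

/-!
# The halted exploration decides `{a₃ ∈ C₁}` (blind cell PercRepro2, p1 g13; the second half of
`ExploreHalt.lean`)

For the exploration from `a₁` halted when `a₃` joins (`Explore.haltRule`, any selector): if `a₃ ∈ C₁(ω)`
then `a₃` is reached (`mem_reached_final_of_conn`: once halted without `a₃`, the reached set is closed
under open adjacency — every open edge touching it was explored (`halted_final`, `pick_none`) and an
explored open edge has both endpoints reached (`mem_reached_of_explored_open`) — and it contains `a₁`,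
so the closure lemma `mem_of_conn_of_closed` applies), and every reached vertex is joined to `a₁` by
explored open edges (`conn_of_mem_reached`), which are open in every configuration of the record's
cylinder. Hence **`haltRule_decides`**: `∀ ω ∈ {a₃ ∈ C₁}, (haltRule.record ω).cyl ⊆ {a₃ ∈ C₁}` — the
hypothesis `hA` of `PathMix.isCylinderPartition_records` / `rv_of_pm_rule` (PathMixBridge.lean): with
it, `PM ≥ 0 ⟹ (ii) ⟹ (RV)` is a statement about the concrete records of the canonical exploration
(BFS, DFS or any fixed order). Nothing about `PM ≥ 0` is claimed. -/

namespace Summit.Ventures.PercRepro2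

namespace Explore

/-! ## The rule decides `{a₃ ∈ C₁}` -/

section Decides
variable {V : Type*} {E : Type*} [DecidableEq V] [DecidableEq E] [Fintype V]
  {ends : E → Sym2 V}

/-- **Invariant (reached ⟹ joined to `a₁` by explored open edges)**: every reached vertex is connected
to `a₁` in every configuration that keeps the explored open edges open. -/
lemma conn_of_mem_reached (sel : Selector ends) (a₁ a₃ : V) (ω : Config E) (n : ℕ) :
    ∀ v ∈ (haltRun sel a₁ a₃ ω n).reached, ∀ ω' : Config E,
      (∀ e ∈ (haltRun sel a₁ a₃ ω n).explored, ω e = true → ω' e = true) → Conn ends ω' a₁ v := by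
  induction n with
  | zero =>
    intro v hv ω' _
    simp only [haltRun, Function.iterate_zero, id_eq, List.mem_singleton] at hv
    rw [hv]
    exact conn_refl ends ω' a₁
  | succ n ih =>
    intro v hv ω' hω'
    rw [haltRun_succ] at hv hω'
    have hmono : ∀ e ∈ (haltRun sel a₁ a₃ ω n).explored, ω e = true → ω' e = true :=
      fun e he => hω' e (explored_subset_haltStep _ _ _ _ he)
    rcases haltStep_cases sel a₃ ω (haltRun sel a₁ a₃ ω n) with h | ⟨e, hp, _, ⟨hωe, h⟩ | ⟨_, h⟩⟩
    · rw [h] at hv; exact ih v hv ω' hmono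
    · rw [h] at hv hω'
      simp only [List.mem_append] at hv
      rcases hv with hv | hv
      · exact ih v hv ω' hmono
      · -- `v` is an endpoint of the open edge `e`, which touches a reached vertex `u`
        have hvE : v ∈ ends e := by
          unfold newEnds at hv
          rw [Finset.mem_toList, Finset.mem_filter] at hv
          exact hv.2.1
        obtain ⟨_, u, hu, huE⟩ := sel.pick_some _ _ e hp
        have hω'e : ω' e = true := hω' e (Finset.mem_insert_self _ _) hωe
        have hconn_u : Conn ends ω' a₁ u := ih u hu ω' hmono
        obtain ⟨w, hw⟩ := Sym2.mem_iff_exists.1 huE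
        have hvw : v = u ∨ v = w := by
          rw [hw] at hvE; exact Sym2.mem_iff.1 hvE
        rcases hvw with rfl | rfl
        · exact hconn_u
        · exact conn_trans hconn_u (conn_of_openAdj ⟨e, hω'e, hw⟩)
    · rw [h] at hv; exact ih v hv ω' hmono

/-- **Invariant (explored open ⟹ endpoints reached)**. -/
lemma mem_reached_of_explored_open (sel : Selector ends) (a₁ a₃ : V) (ω : Config E) (n : ℕ) :
    ∀ e ∈ (haltRun sel a₁ a₃ ω n).explored, ω e = true →
      ∀ v ∈ ends e, v ∈ (haltRun sel a₁ a₃ ω n).reached := by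
  induction n with
  | zero =>
    intro e he
    simp [haltRun] at he
  | succ n ih =>
    intro e he hωe v hv
    rw [haltRun_succ] at he ⊢
    rcases haltStep_cases sel a₃ ω (haltRun sel a₁ a₃ ω n) with h | ⟨e', _, _, ⟨hωe', h⟩ | ⟨hωe', h⟩⟩
    · rw [h] at he ⊢; exact ih e he hωe v hv
    · rw [h] at he ⊢
      simp only [Finset.mem_insert] at he
      rcases he with rfl | he
      · exact mem_append_newEnds ends hv
      · exact List.mem_append_left _ (ih e he hωe v hv)
    · rw [h] at he ⊢
      simp only [Finset.mem_insert] at he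
      rcases he with rfl | he
      · rw [hωe] at hωe'; exact Bool.noConfusion hωe'
      · exact ih e he hωe v hv

/-- A step that is not halted explores one new edge. -/
lemma card_explored_haltStep (sel : Selector ends) (a₃ : V) (ω : Config E) (s : HaltState V E)
    (h : ¬ Halted sel a₃ s) :
    (haltStep sel a₃ ω s).explored.card = s.explored.card + 1 := by
  have h3 : a₃ ∉ s.reached := fun h' => h (Or.inl h')
  have hp : sel.pick s.reached s.explored ≠ none := fun h' => h (Or.inr h')
  obtain ⟨e, he⟩ := Option.ne_none_iff_exists'.1 hp
  have hnot : e ∉ s.explored := (sel.pick_some _ _ e he).1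
  cases hω : ω e
  · simp [haltStep, h3, he, hω, Finset.card_insert_of_notMem hnot]
  · simp [haltStep, h3, he, hω, Finset.card_insert_of_notMem hnot]

/-- Halting is absorbing along the run. -/
lemma halted_mono (sel : Selector ends) (a₁ a₃ : V) (ω : Config E) {n : ℕ}
    (h : Halted sel a₃ (haltRun sel a₁ a₃ ω n)) : Halted sel a₃ (haltRun sel a₁ a₃ ω (n + 1)) := by
  rw [haltRun_succ, haltStep_of_halted ω h]; exact h

/-- Along the run, either the state is halted or `n` edges have been explored. -/
lemma halted_or_card (sel : Selector ends) (a₁ a₃ : V) (ω : Config E) (n : ℕ) :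
    Halted sel a₃ (haltRun sel a₁ a₃ ω n) ∨ n ≤ (haltRun sel a₁ a₃ ω n).explored.card := by
  induction n with
  | zero => right; exact Nat.zero_le _
  | succ n ih =>
    by_cases h : Halted sel a₃ (haltRun sel a₁ a₃ ω n)
    · left; exact halted_mono sel a₁ a₃ ω h
    · rcases ih with ih | ih
      · exact absurd ih h
      · right
        rw [haltRun_succ, card_explored_haltStep sel a₃ ω _ h]
        exact Nat.succ_le_succ ih

variable [Fintype E]

/-- **After `|E|` steps the exploration is halted.** -/
lemma halted_final (sel : Selector ends) (a₁ a₃ : V) (ω : Config E) :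
    Halted sel a₃ (haltFinal sel a₁ a₃ ω) := by
  rcases halted_or_card sel a₁ a₃ ω (Fintype.card E) with h | h
  · exact h
  · -- every edge is explored, so nothing can be picked
    right
    have huniv : (haltFinal sel a₁ a₃ ω).explored = Finset.univ :=
      Finset.eq_univ_of_card _ (le_antisymm (Finset.card_le_univ _) h)
    cases hp : sel.pick (haltFinal sel a₁ a₃ ω).reached (haltFinal sel a₁ a₃ ω).explored with
    | none => rfl
    | some e =>
      exact absurd (by rw [huniv]; exact Finset.mem_univ e) (sel.pick_some _ _ e hp).1

/-- **If `a₃ ∈ C₁(ω)` then `a₃` is reached**: once halted without `a₃`, the reached set is closed under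
open adjacency and contains `a₁`. -/
lemma mem_reached_final_of_conn (sel : Selector ends) (a₁ a₃ : V) (ω : Config E)
    (h : Conn ends ω a₁ a₃) : a₃ ∈ (haltFinal sel a₁ a₃ ω).reached := by
  by_contra h3
  have hnone : sel.pick (haltFinal sel a₁ a₃ ω).reached (haltFinal sel a₁ a₃ ω).explored = none := by
    rcases halted_final sel a₁ a₃ ω with h' | h'
    · exact absurd h' h3
    · exact h'
  have ha₁ : a₁ ∈ (haltFinal sel a₁ a₃ ω).reached :=
    mem_reached_mono sel a₁ a₃ ω (Nat.zero_le _) (by simp [haltRun])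
  have hclosed : ∀ x ∈ ({v | v ∈ (haltFinal sel a₁ a₃ ω).reached} : Set V), ∀ y,
      (openGraph ends ω).Adj x y → y ∈ ({v | v ∈ (haltFinal sel a₁ a₃ ω).reached} : Set V) := by
    intro x hx y hxy
    obtain ⟨_, e, hωe, hends⟩ := openGraph_adj.1 hxy
    have hxE : x ∈ ends e := by rw [hends]; exact Sym2.mem_mk_left x y
    have hyE : y ∈ ends e := by rw [hends]; exact Sym2.mem_mk_right x y
    have he : e ∈ (haltFinal sel a₁ a₃ ω).explored := by
      by_contra hne
      exact sel.pick_none _ _ hnone e hne x hx hxE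
    exact mem_reached_of_explored_open sel a₁ a₃ ω _ e he hωe y hyE
  exact h3 (mem_of_conn_of_closed hclosed ha₁ h)

/-- **The halted exploration decides `{a₃ ∈ C₁}`**: if `a₃ ∈ C₁(ω)`, every configuration showing the
record of `ω` has `a₃ ∈ C₁`. -/
theorem haltRule_decides (sel : Selector ends) (a₁ a₃ : V) :
    ∀ ω ∈ connEvent ends a₁ a₃, ((haltRule sel a₁ a₃).record ω).cyl ⊆ connEvent ends a₁ a₃ := by
  intro ω hω ω' hω'
  have h3 := mem_reached_final_of_conn sel a₁ a₃ ω hω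
  refine conn_of_mem_reached sel a₁ a₃ ω _ a₃ h3 ω' fun e he hωe => ?_
  exact hω'.1 e (Finset.mem_filter.2 ⟨he, hωe⟩)

end Decides

end Explore

end Summit.Ventures.PercRepro2
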